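import Mathlib
import Summits.Ventures.CertifiedArithmetic.LowPrec.OptScaleNesting

/-!
# Opt / R4 — Theorems S3, S5 (L∞ and SSE), S6-inf and S6 (SSE): two candidates, minimax-optimality of the non-clipping rule, and the exact gain of any scale search — E2M1, E2M3, E3M2

HONEST FRAMING: certified error envelopes and provably optimal rounding/accumulation schemes for
low-precision formats under stated cost models; every table by two implementations; no hardware or
vendor claims.

Setting (OPTIMA.md §S, cost model CM-S; MX-type shared power-of-two scales, round-to-nearest with
saturation, block L∞ error). For an element format with integer magnitude grid `B` (the `Lo` grids of
`OptScaleNesting.lean`: `e2m1Lo` top `T = 12`, `e2m3Lo` top `60`, `e3m2Lo` top `448`) the value grid at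
*scale parameter* `s` is `s • B` with top (clip) point `T s`; the absolute element error of saturating
round-to-nearest is `gridDist (s • B) y` and the block error is the maximum over the elements. For a block
of nonnegative elements with maximum `a` the NON-CLIPPING candidate is the least power-of-two scale whose
top is `≥ a`: `T s / 2 < a ≤ T s`.

THEOREM S3 (`two_candidates`, generic; instances `two_candidates_e2m1/_e2m3/_e3m2`): every coarser scale
`2^n s` is never strictly better (elementwise, hence in L∞) and every scale `s / 2^n` with `n ≥ 2` is
strictly worse in L∞; hence an L∞-optimal power-of-two scale is `s` or `s/2` — the two candidates of
OPTIMA.md Theorem S3 (which one wins is data dependent, Theorems S3/S5). Hypotheses on `B` (all decided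
by `decide` for the three grids): `T ∈ B`, every point `≤ T`, doubling closed below `T`
(`n ∈ B → 2n ≤ T → 2n ∈ B`, i.e. nesting of the grid at `2s` into the grid at `s` below the clip point),
and a covering radius `R s` on `[0, T s]` with `4 R ≤ T` (`R = 2, 2, 32`).

THEOREM S5, L∞ half (`ceil_vs_half`, generic; `ceil_minimax_e2m1/_e2m3/_e3m2`): among amax-only rules the
non-clipping ("ceil") rule is MINIMAX-optimal over all power-of-two scales: for the one comparison S3 leaves
open (the half scale) an explicit adversarial block with the same maximum is constructed (second section);
its SSE half (`ceil_vs_half_sse`, `finer_sse_const`, `ceil_minimax_sse_e2m1/_e2m3/_e3m2`) is in the third section.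
COROLLARY S6-inf (`blockErr_coarse_le_add`, `search_gain_le_e2m1/_e2m3/_e3m2`): no power-of-two scale beats the
non-clipping scale by more than `u` (half its finest spacing) in block L∞ error.
THEOREM S6 (`sse_gain_le`, generic; `sse_search_gain_le_e2m1/_e2m3/_e3m2`): no power-of-two scale beats the
non-clipping scale by more than `(k-1) u²` in block SSE, and the bound is ATTAINED by the block
`(T u + u, u, …, u)` (`sse_gain_attained`, `sse_gain_attained_e2m1/_e2m3/_e3m2`) (third section).

STAGED by the opt seat (pub-lowprec-opt) for the lean seat / lead to propose (suggested target
`Summits/Ventures/CertifiedArithmetic/LowPrec/OptTwoCandidates.lean`; imports only Mathlib and the landed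
`OptScaleNesting`); `lean check` rc 0, no sorry. The block at the end gives the venture-`Statement.lean`
style Props `R4_TwoCandidates{E2M1,E2M3,E3M2}` with their discharges.

AUTHORSHIP: written and kernel-checked by the opt seat (`pub-lowprec-opt`, frozen 2026-08-19T22:34Z,
whole-file sha256 prefix `a51b5f492dddc339`, 63 declarations, 0 sorry); split into four tree files of
≤ 400 lines (`OptTwoCandidates`, `OptCeilMinimax`, `OptSSEGain`, `OptSSEGainInstances`) and proposed
verbatim (plus seven one-line docstrings) by the lean seat at the cell lead's request.
-/

namespace Summit.Ventures.CertifiedArithmetic.LowPrec.Opt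

section Generic

variable {K : Type*} [Field K] [LinearOrder K] [IsStrictOrderedRing K]
/-- the grid `s • B` -/
def sgrid (B : Finset ℕ) (s : K) : Finset K := B.image (fun n : ℕ => s * (n : K))

omit [IsStrictOrderedRing K] in
/-- The scaled grid is nonempty when `B` is. -/
theorem sgrid_nonempty {B : Finset ℕ} (hB : B.Nonempty) (s : K) : (sgrid B s : Finset K).Nonempty :=
  hB.image _

omit [IsStrictOrderedRing K] in
/-- Scaled grid points are members of the scaled grid. -/
theorem mem_sgrid {B : Finset ℕ} {s : K} {n : ℕ} (h : n ∈ B) : s * (n : K) ∈ (sgrid B s : Finset K) :=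
  Finset.mem_image.mpr ⟨n, h, rfl⟩

/-- element error at scale parameter `s` -/
def err {B : Finset ℕ} (hB : B.Nonempty) (s y : K) : K := gridDist (sgrid B s) (sgrid_nonempty hB s) y

/-- block L∞ error of `x : Fin k → K` (nonempty via the index `i₀`) -/
def blockErr {B : Finset ℕ} (hB : B.Nonempty) {k : ℕ} (s : K) (x : Fin k → K) (i₀ : Fin k) : K :=
  Finset.univ.sup' ⟨i₀, Finset.mem_univ _⟩ (fun i => err hB s (x i))

variable {B : Finset ℕ} (hB : B.Nonempty)

/-- nesting, scaled: every point of the grid at `2s` below the clip point `T s` is a point of the grid at `s` -/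
theorem sgrid_nested {T : ℕ} (hdouble : ∀ n ∈ B, 2 * n ≤ T → 2 * n ∈ B) {s : K} (hs : 0 < s) :
    ∀ a ∈ (sgrid B (2 * s) : Finset K), a ≤ (T : K) * s → a ∈ (sgrid B s : Finset K) := by
  intro a ha hle
  obtain ⟨n, hn, rfl⟩ := Finset.mem_image.mp ha
  have h2n : 2 * n ≤ T := by
    have h : (2 * n : K) ≤ T := by nlinarith
    exact_mod_cast h
  have hmem := mem_sgrid (s := s) (hdouble n hn h2n)
  have e : s * ((2 * n : ℕ) : K) = 2 * s * (n : K) := by push_cast; ring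
  rw [e] at hmem
  exact hmem

/-- **S2(i), scaled.** Halving never increases the error of an element below the lower clip point. -/
theorem halving_le {T : ℕ} (hT : T ∈ B) (hdouble : ∀ n ∈ B, 2 * n ≤ T → 2 * n ∈ B) {s y : K}
    (hs : 0 < s) (hy : y ≤ (T : K) * s) : err hB s y ≤ err hB (2 * s) y := by
  have hTs : (T : K) * s ∈ (sgrid B s : Finset K) := by
    have := mem_sgrid (s := s) hT
    rw [mul_comm] at this; exact this
  exact gridDist_mono_of_nested_below_cut _ _ hTs hy (sgrid_nested hdouble hs)

/-- **S3(i).** Every coarser power-of-two scale is never strictly better, elementwise. -/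
theorem coarser_le {T : ℕ} (hT : T ∈ B) (hdouble : ∀ n ∈ B, 2 * n ≤ T → 2 * n ∈ B) {s y : K}
    (hs : 0 < s) (hy : y ≤ (T : K) * s) (n : ℕ) : err hB s y ≤ err hB (2 ^ n * s) y := by
  induction n with
  | zero => simp
  | succ n ih =>
    have hs' : 0 < 2 ^ n * s := by positivity
    have hy' : y ≤ (T : K) * (2 ^ n * s) := by
      have h1 : s ≤ 2 ^ n * s := le_mul_of_one_le_left hs.le (one_le_pow₀ (by norm_num))
      have hT0 : (0 : K) ≤ T := Nat.cast_nonneg T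
      nlinarith
    have e : (2 : K) ^ (n + 1) * s = 2 * (2 ^ n * s) := by ring
    rw [e]
    exact ih.trans (halving_le hB hT hdouble hs' hy')

/-- a grid point within `R s` of `y` bounds the error -/
theorem err_le_of_near {s y R : K} {n : ℕ} (hn : n ∈ B) (h1 : s * (n : K) - R * s ≤ y)
    (h2 : y ≤ s * (n : K) + R * s) : err hB s y ≤ R * s := by
  refine (gridDist_le_of_mem (sgrid_nonempty hB s) (mem_sgrid hn)).trans ?_
  rw [abs_le]; constructor <;> linarith

/-- clipping lower bound: no grid point above `T s`, so `err s y ≥ y - T s` -/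
theorem sub_top_le_err {T : ℕ} (hle : ∀ n ∈ B, n ≤ T) {s : K} (hs : 0 ≤ s) (y : K) :
    y - (T : K) * s ≤ err hB s y := by
  unfold err gridDist
  apply Finset.le_inf'
  intro v hv
  obtain ⟨n, hn, rfl⟩ := Finset.mem_image.mp hv
  have hnT : (n : K) ≤ T := by exact_mod_cast hle n hn
  have : s * (n : K) ≤ (T : K) * s := by nlinarith
  exact le_trans (by linarith) (le_abs_self _)

/-- **S3(ii), elementwise core.** If `a > T s / 2` (the half scale clips `a`), then at every scale
`s / 2^n`, `n ≥ 2`, the error of `a` exceeds the error at scale `s` of ANY `y ∈ [0, T s]`, provided the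
covering radius `R s` of the grid satisfies `4 R ≤ T`. -/
theorem finer_clips_lt {T : ℕ} (hle : ∀ n ∈ B, n ≤ T) {R s a y : K} (hR : 4 * R ≤ T)
    (hcov : err hB s y ≤ R * s) (hs : 0 < s) (ha : (T : K) * s < 2 * a) {n : ℕ} (hn : 2 ≤ n) :
    err hB s y < err hB (s / 2 ^ n) a := by
  have h4 : (4 : K) ≤ 2 ^ n := by
    have : (2 : K) ^ 2 ≤ 2 ^ n := pow_le_pow_right₀ (by norm_num) hn
    norm_num at this; exact this
  have hpos : (0 : K) < 2 ^ n := by positivity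
  have hsn : 0 ≤ s / 2 ^ n := by positivity
  have hT0 : (0 : K) ≤ T := Nat.cast_nonneg T
  have hTs0 : 0 ≤ (T : K) * s := by positivity
  have htop : (T : K) * (s / 2 ^ n) ≤ (T : K) * s / 4 := by
    rw [mul_div_assoc', div_le_div_iff₀ hpos (by norm_num : (0:K) < 4)]
    nlinarith [mul_le_mul_of_nonneg_left h4 hTs0]
  have h2 := sub_top_le_err hB hle hsn a
  nlinarith

/-- **Theorem S3 (generic): the L∞-optimal power-of-two scale is one of two candidates.** -/
theorem two_candidates {T : ℕ} (hT : T ∈ B) (hle : ∀ n ∈ B, n ≤ T)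
    (hdouble : ∀ n ∈ B, 2 * n ≤ T → 2 * n ∈ B) {R : K} (hR : 4 * R ≤ T)
    (hcov : ∀ s y : K, 0 < s → 0 ≤ y → y ≤ (T : K) * s → err hB s y ≤ R * s)
    {k : ℕ} (x : Fin k → K) {s a : K} (hs : 0 < s) (hx0 : ∀ i, 0 ≤ x i) (hxa : ∀ i, x i ≤ a)
    (ha : a ≤ (T : K) * s) (ha' : (T : K) * s < 2 * a) (i₀ : Fin k) (hi₀ : x i₀ = a) :
    (∀ n : ℕ, blockErr hB s x i₀ ≤ blockErr hB (2 ^ n * s) x i₀) ∧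
    (∀ n : ℕ, 2 ≤ n → blockErr hB s x i₀ < blockErr hB (s / 2 ^ n) x i₀) := by
  constructor
  · intro n
    refine Finset.sup'_le _ _ (fun i _ => ?_)
    exact (coarser_le hB hT hdouble hs ((hxa i).trans ha) n).trans
      (Finset.le_sup' (fun i => err hB (2 ^ n * s) (x i)) (Finset.mem_univ i))
  · intro n hn
    have hlt : ∀ i, err hB s (x i) < err hB (s / 2 ^ n) a :=
      fun i => finer_clips_lt hB hle hR (hcov s (x i) hs (hx0 i) ((hxa i).trans ha)) hs ha' hn
    have hle' : err hB (s / 2 ^ n) a ≤ blockErr hB (s / 2 ^ n) x i₀ := by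
      rw [← hi₀]
      exact Finset.le_sup' (fun i => err hB (s / 2 ^ n) (x i)) (Finset.mem_univ i₀)
    exact lt_of_lt_of_le ((Finset.sup'_lt_iff _).mpr (fun i _ => hlt i)) hle'

end Generic

/-! ### Instances: E2M1 (`T = 12`, `R = 2`), E2M3 (`T = 60`, `R = 2`), E3M2 (`T = 448`, `R = 32`) -/

section Instances

variable {K : Type*} [Field K] [LinearOrder K] [IsStrictOrderedRing K]

/-- `0 ∈ e2m1Lo`, so the E2M1 magnitude grid is nonempty. -/
theorem e2m1Lo_ne : e2m1Lo.Nonempty := ⟨0, by decide⟩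
/-- `0 ∈ e2m3Lo`, so the E2M3 magnitude grid is nonempty. -/
theorem e2m3Lo_ne : e2m3Lo.Nonempty := ⟨0, by decide⟩
/-- `0 ∈ e3m2Lo`, so the E3M2 magnitude grid is nonempty. -/
theorem e3m2Lo_ne : e3m2Lo.Nonempty := ⟨0, by decide⟩

/-- covering radius `2 s` of `s • e2m1Lo` on `[0, 12 s]` (centres at the multiples of `4`, all grid points). -/
theorem e2m1_cov {s y : K} (hs : 0 < s) (hy0 : 0 ≤ y) (hy : y ≤ 12 * s) :
    err e2m1Lo_ne s y ≤ 2 * s := by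
  by_cases h0 : y ≤ 2 * s
  · exact err_le_of_near e2m1Lo_ne (n := 0) (by decide) (by push_cast; linarith) (by push_cast; linarith)
  by_cases h1 : y ≤ 6 * s
  · exact err_le_of_near e2m1Lo_ne (n := 4) (by decide) (by push_cast; linarith) (by push_cast; linarith)
  by_cases h2 : y ≤ 10 * s
  · exact err_le_of_near e2m1Lo_ne (n := 8) (by decide) (by push_cast; linarith) (by push_cast; linarith)
  · exact err_le_of_near e2m1Lo_ne (n := 12) (by decide) (by push_cast; linarith) (by push_cast; linarith)

/-- covering radius `2 s` of `s • e2m3Lo` on `[0, 60 s]` (centres at the multiples of `4`, all grid points). -/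
theorem e2m3_cov {s y : K} (hs : 0 < s) (hy0 : 0 ≤ y) (hy : y ≤ 60 * s) :
    err e2m3Lo_ne s y ≤ 2 * s := by
  by_cases h0 : y ≤ 2 * s
  · exact err_le_of_near e2m3Lo_ne (n := 0) (by decide) (by push_cast; linarith) (by push_cast; linarith)
  by_cases h1 : y ≤ 6 * s
  · exact err_le_of_near e2m3Lo_ne (n := 4) (by decide) (by push_cast; linarith) (by push_cast; linarith)
  by_cases h2 : y ≤ 10 * s
  · exact err_le_of_near e2m3Lo_ne (n := 8) (by decide) (by push_cast; linarith) (by push_cast; linarith)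
  by_cases h3 : y ≤ 14 * s
  · exact err_le_of_near e2m3Lo_ne (n := 12) (by decide) (by push_cast; linarith) (by push_cast; linarith)
  by_cases h4 : y ≤ 18 * s
  · exact err_le_of_near e2m3Lo_ne (n := 16) (by decide) (by push_cast; linarith) (by push_cast; linarith)
  by_cases h5 : y ≤ 22 * s
  · exact err_le_of_near e2m3Lo_ne (n := 20) (by decide) (by push_cast; linarith) (by push_cast; linarith)
  by_cases h6 : y ≤ 26 * s
  · exact err_le_of_near e2m3Lo_ne (n := 24) (by decide) (by push_cast; linarith) (by push_cast; linarith)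
  by_cases h7 : y ≤ 30 * s
  · exact err_le_of_near e2m3Lo_ne (n := 28) (by decide) (by push_cast; linarith) (by push_cast; linarith)
  by_cases h8 : y ≤ 34 * s
  · exact err_le_of_near e2m3Lo_ne (n := 32) (by decide) (by push_cast; linarith) (by push_cast; linarith)
  by_cases h9 : y ≤ 38 * s
  · exact err_le_of_near e2m3Lo_ne (n := 36) (by decide) (by push_cast; linarith) (by push_cast; linarith)
  by_cases h10 : y ≤ 42 * s
  · exact err_le_of_near e2m3Lo_ne (n := 40) (by decide) (by push_cast; linarith) (by push_cast; linarith)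
  by_cases h11 : y ≤ 46 * s
  · exact err_le_of_near e2m3Lo_ne (n := 44) (by decide) (by push_cast; linarith) (by push_cast; linarith)
  by_cases h12 : y ≤ 50 * s
  · exact err_le_of_near e2m3Lo_ne (n := 48) (by decide) (by push_cast; linarith) (by push_cast; linarith)
  by_cases h13 : y ≤ 54 * s
  · exact err_le_of_near e2m3Lo_ne (n := 52) (by decide) (by push_cast; linarith) (by push_cast; linarith)
  by_cases h14 : y ≤ 58 * s
  · exact err_le_of_near e2m3Lo_ne (n := 56) (by decide) (by push_cast; linarith) (by push_cast; linarith)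
  · exact err_le_of_near e2m3Lo_ne (n := 60) (by decide) (by push_cast; linarith) (by push_cast; linarith)

/-- covering radius `32 s` of `s • e3m2Lo` on `[0, 448 s]` (centres at the multiples of `64`, all grid points). -/
theorem e3m2_cov {s y : K} (hs : 0 < s) (hy0 : 0 ≤ y) (hy : y ≤ 448 * s) :
    err e3m2Lo_ne s y ≤ 32 * s := by
  by_cases h0 : y ≤ 32 * s
  · exact err_le_of_near e3m2Lo_ne (n := 0) (by decide) (by push_cast; linarith) (by push_cast; linarith)
  by_cases h1 : y ≤ 96 * s
  · exact err_le_of_near e3m2Lo_ne (n := 64) (by decide) (by push_cast; linarith) (by push_cast; linarith)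
  by_cases h2 : y ≤ 160 * s
  · exact err_le_of_near e3m2Lo_ne (n := 128) (by decide) (by push_cast; linarith) (by push_cast; linarith)
  by_cases h3 : y ≤ 224 * s
  · exact err_le_of_near e3m2Lo_ne (n := 192) (by decide) (by push_cast; linarith) (by push_cast; linarith)
  by_cases h4 : y ≤ 288 * s
  · exact err_le_of_near e3m2Lo_ne (n := 256) (by decide) (by push_cast; linarith) (by push_cast; linarith)
  by_cases h5 : y ≤ 352 * s
  · exact err_le_of_near e3m2Lo_ne (n := 320) (by decide) (by push_cast; linarith) (by push_cast; linarith)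
  by_cases h6 : y ≤ 416 * s
  · exact err_le_of_near e3m2Lo_ne (n := 384) (by decide) (by push_cast; linarith) (by push_cast; linarith)
  · exact err_le_of_near e3m2Lo_ne (n := 448) (by decide) (by push_cast; linarith) (by push_cast; linarith)

/-- **S3 for E2M1** (FP4 / MXFP4 elements): grid `s • {0,1,2,3,4,6,8,12}` = FP4 values at scale `2s`. -/
theorem two_candidates_e2m1 {k : ℕ} (x : Fin k → K) {s a : K} (hs : 0 < s) (hx0 : ∀ i, 0 ≤ x i)
    (hxa : ∀ i, x i ≤ a) (ha : a ≤ (12 : ℕ) * s) (ha' : ((12 : ℕ) : K) * s < 2 * a) (i₀ : Fin k)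
    (hi₀ : x i₀ = a) :
    (∀ n : ℕ, blockErr e2m1Lo_ne s x i₀ ≤ blockErr e2m1Lo_ne (2 ^ n * s) x i₀) ∧
    (∀ n : ℕ, 2 ≤ n → blockErr e2m1Lo_ne s x i₀ < blockErr e2m1Lo_ne (s / 2 ^ n) x i₀) :=
  two_candidates e2m1Lo_ne (T := 12) (by decide) (by decide) (by decide) (R := 2) (by norm_num)
    (fun s y hs hy0 hy => e2m1_cov hs hy0 (by simpa using hy)) x hs hx0 hxa ha ha' i₀ hi₀

/-- **S3 for E2M3** (FP6 E2M3 elements): grid `s • e2m3Lo` (top `60 s` = `7.5 t`, `t = 8 s`). -/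
theorem two_candidates_e2m3 {k : ℕ} (x : Fin k → K) {s a : K} (hs : 0 < s) (hx0 : ∀ i, 0 ≤ x i)
    (hxa : ∀ i, x i ≤ a) (ha : a ≤ (60 : ℕ) * s) (ha' : ((60 : ℕ) : K) * s < 2 * a) (i₀ : Fin k)
    (hi₀ : x i₀ = a) :
    (∀ n : ℕ, blockErr e2m3Lo_ne s x i₀ ≤ blockErr e2m3Lo_ne (2 ^ n * s) x i₀) ∧
    (∀ n : ℕ, 2 ≤ n → blockErr e2m3Lo_ne s x i₀ < blockErr e2m3Lo_ne (s / 2 ^ n) x i₀) :=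
  two_candidates e2m3Lo_ne (T := 60) (by decide) (by decide) (by decide) (R := 2) (by norm_num)
    (fun s y hs hy0 hy => e2m3_cov hs hy0 (by simpa using hy)) x hs hx0 hxa ha ha' i₀ hi₀

/-- **S3 for E3M2** (FP6 E3M2 elements): grid `s • e3m2Lo` (top `448 s` = `28 t`, `t = 16 s`). -/
theorem two_candidates_e3m2 {k : ℕ} (x : Fin k → K) {s a : K} (hs : 0 < s) (hx0 : ∀ i, 0 ≤ x i)
    (hxa : ∀ i, x i ≤ a) (ha : a ≤ (448 : ℕ) * s) (ha' : ((448 : ℕ) : K) * s < 2 * a) (i₀ : Fin k)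
    (hi₀ : x i₀ = a) :
    (∀ n : ℕ, blockErr e3m2Lo_ne s x i₀ ≤ blockErr e3m2Lo_ne (2 ^ n * s) x i₀) ∧
    (∀ n : ℕ, 2 ≤ n → blockErr e3m2Lo_ne s x i₀ < blockErr e3m2Lo_ne (s / 2 ^ n) x i₀) :=
  two_candidates e3m2Lo_ne (T := 448) (by decide) (by decide) (by decide) (R := 32) (by norm_num)
    (fun s y hs hy0 hy => e3m2_cov hs hy0 (by simpa using hy)) x hs hx0 hxa ha ha' i₀ hi₀

end Instances

end Summit.Ventures.CertifiedArithmetic.LowPrec.Opt
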